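/-
Copyright: the b2b-balaban cell (near-miss cell 7), T⁴-continuum fan-out; row NE7b ROUND-2 swarm, seat
t4-ne7b-formalise-leaf-03 (row S12 «ASSEMBLY» of `t4/b2b-balaban-t4-ne7b-p1/LEAVES-NE7b.md`; node A12-I.3 of the
typer's `t4/formal/NE7b/DAG.md`).  Released under the licence of the surrounding project.
-/
import Summits.QuantumFields.BalabanUV.T4Continuum.Support.HistoryAssemblyPedigree
import Summits.QuantumFields.BalabanUV.T4Continuum.Support.HistoryConstantsTH

/-!
# History assembly, PRINTED PRICES: the per-term price reading at print's displayed constants (`Dominates C O`)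

Summits-side support leaf of the T⁴-continuum cell (rung (B)+1 on a FINITE torus only; NOT infinite volume, NOT the
mass gap, NOT the Clay statement; NOT a proof of the spine estimate NE7b).  Row NE7b, route «COUNT», ROUND-2 swarm
row S12, typer node A12-I.3 («printed price: `hprice` in `pshapeTH`∕printed currency via S9b + `Dominates`»;
acceptance test `t4/formal/NE7b/ACCEPT-A12I.md` §B5).  [folklore] COMPOSITION BY NAME of row S9b
(`HistoryConstantsTH`, leaf-04: `pshapeTH`, `Dominates.le_prod_shapeTH`, the slack variant `le_prod_shapeTH_of_slack`)
with the pedigree-keyed END of S12 (`HistoryAssemblyPedigree`).  Nothing is quoted from print, nothing printed is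
asserted, no `[cite:]` tag, no `Prop`-valued fact of Bałaban's is minted (trigger c1); print's O(1)'s are the SYMBOLIC
record `O : PrintedO1s` of row S9 (c2∕c6); H3's price sentence, (B) and the BetaPertH-flow facts are DISPLAYED (c4).

WHAT.  §1 `priceT_eq_cshapeTH` (the assembly's member price is row S9b's `HistoryConstants.shapeTH` at `Δ = 1`,
`D = 0`), **`hprice_of_printed`**: under `Dominates C O`, a per-term price reading stated with PRINT's per-operation
factors — `pshapeTH sh O C 1 Λ′ (R K) (g K) 0 (κ K q) q.2` with a REALISED per-step cost `κ` read below the model's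
`costT` on the member's life (reading (ID-a), displayed; typer T-NE7b-4: date `κ` in the encoding) — gives the
model-currency reading `hprice` of `HistoryAssemblyTerms`∕`HistoryAssemblyPedigree`; **`hprice_of_printed_slack`**: the
same with an extra class-linear factor `e^{θ·birthLinT}` per member (print's resummation sentence p. 383 ∕
lattice-animal entropy, displayed INSIDE the H3 bound), paid by the birth-credit slack `C.a + θ ≤ ½γ₀A₁²` (row S9c's
mechanism in S9b's form) given a profile floor `1 ≤ p₀(g_{K,s})` at the members' birth steps.  §2
**`hybridNE7_of_pedigreeReading_printed`**: the END of `HistoryAssemblyPedigree` with `hprice`∕`hprice′` REPLACED by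
`Dominates C O` + the printed-currency readings + the realised-cost readings.

DISPLAYED after §2 (ACCEPT-A12I §B): B1 constants (`ThresholdOK`, `0 < μ`, κ₁∕E₀ largeness, `Dominates C O` with
`O : PrintedO1s` symbolic); B2 flow (⇐ BetaPertH) + tuning + `irThresholdTH … ≤ log g⁻²` + (2.5) side condition; B3
the (B) side; B4 the `Regeneration` numerator fields; B5 the reading map `ped`∕`liveC`∕`cellOf` with `PedigreeReading`
(node A12-I.2 replaces it by S1b's `Realises`) AND the printed per-term price sentences with realised costs; B7 seams.
HEADLINE (c4): «COUNT route reduced to H3 (pedigree reading + printed price sentence) + `Dominates` + (B) +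
BetaPertH-flow + NE7c socket + NE7 core budget, displayed (sub-class: RenewAtReach in `Timed`, NoDropInLife)» — NOT
«NE7b proved».  HONEST DEPENDENCY (cell): continuum YM on T⁴ ⇐ BetaPertH ∧ nine spine estimates (0/9 proved);
BetaPertH ⇐ (D1) ∧ (D4) ∧ CAP+tail.  This file changes none of it.
-/

open Finset MeasureTheory
open Literature.MathematicalPhysics.QuantumFieldTheory.Balaban1983to89
open T4PersistenceDictionary T4PersistentHistoryCount T4BankedInduction T4PrintedShapeBanking
open T4WeightBudget T4GlobalDenominator T4LiveClassFibration T4LiveStructureGas T4LiveGasToTerms T4RecordPriceSeam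
open T4PartnerMultiplicity T4IndicatorShell T4MatchingAssembly T4MatchingClosure T4MatchingClosureSocket T4Continuum
open T4StabilitySocket T4BranchingRecordsGas T4TaggedShapeBanking T4CanonicalMenus T4RenewalChains
open Summit.QuantumFields.BalabanUV.T4Continuum.PlacementBatch
open Summit.QuantumFields.BalabanUV.T4Continuum.PlacementSkeleton
open Summit.QuantumFields.BalabanUV.T4Continuum.CountThresholdUniform
open Summit.QuantumFields.BalabanUV.T4Continuum.CountThresholdExit
open Summit.QuantumFields.BalabanUV.T4Continuum.CountSeamJunction
open Summit.QuantumFields.BalabanUV.T4Continuum.LateMergers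
open Summit.QuantumFields.BalabanUV.T4Continuum.HistoryFlow
open Summit.QuantumFields.BalabanUV.T4Continuum.HistoryRegeneration
open Summit.QuantumFields.BalabanUV.T4Continuum.HistoryTables
open Summit.QuantumFields.BalabanUV.T4Continuum.HistoryAssemblyTrees
open Summit.QuantumFields.BalabanUV.T4Continuum.HistoryAssemblyTerms
open Summit.QuantumFields.BalabanUV.T4Continuum.HistoryAssemblyPedigree
open Summit.QuantumFields.BalabanUV.T4Continuum.HistoryConstants
open Summit.QuantumFields.BalabanUV.T4Continuum.HistoryGen

namespace Summit.QuantumFields.BalabanUV.T4Continuum.HistoryAssemblyPrice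

noncomputable section

/-! ## §1 Printed-currency price readings give the model-currency reading -/

section Printed

variable {ε γ ι : Type*} [DecidableEq ε] [DecidableEq γ] {C : T4PrintedShapeBanking.Consts} {O : PrintedO1s}

omit [DecidableEq γ] in
/-- the assembly's member price IS row S9b's model shape at `Δ = 1`, `D = 0` (`one_mul`, `padW W 0 = W`). [folklore] -/
theorem priceT_eq_cshapeTH (sh : ε → PEv) (C : T4PrintedShapeBanking.Consts) (Λ' : ℝ) (R : ℕ → ℕ → ℕ)
    (g : ℕ → ℕ → ℝ) (K : ℕ) (q : γ × Gen ε) :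
    priceT sh C Λ' R g K q = HistoryConstants.shapeTH sh C 1 Λ' (R K) (g K) K 0 q.2 := by
  rw [priceT, HistoryConstants.shapeTH, one_mul, padW_zero]

/-- **PRINTED PRICES GIVE THE MODEL-CURRENCY READING.**  Under `Dominates C O`: if the live price of the class of every
bad term is below the product over its members of PRINT's per-operation factors `pshapeTH … (κ K q) q.2` — print's
credits at the symbolic O(1)'s, a REALISED per-step cost `κ` — and every realised cost is read below the model's `costT`
on the member's life, then the reading holds in the model's currency `priceT` (`Dominates.le_prod_shapeTH`). [folklore] -/
theorem hprice_of_printed (sh : ε → PEv) (hD : Dominates C O) {Λ' : ℝ} (hΛ : 0 ≤ Λ') (R : ℕ → ℕ → ℕ)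
    (g : ℕ → ℕ → ℝ) {l₀ : ℝ} {K₀ : ℕ} {T : ℕ → Finset ι} {mem : ℕ → ι → Finset (γ × Gen ε)} {jstar : ℕ → ℕ}
    {Fc Rf : ℕ → Finset (BSlot γ PEv) → ℝ} (κ : ℕ → γ × Gen ε → Gen ε → ℕ → ℝ)
    (hκ : ∀ K, K₀ ≤ K → ∀ τ ∈ badTerms mem jstar T K, ∀ q ∈ mem K τ,
      ∀ n ∈ life (padW (dictWT sh (R K) C.n₁) 0) q.2, κ K q q.2 n ≤ costT sh C K (R K) q.2 n)
    (hP : ∀ K t, |t| ≤ l₀ → K₀ ≤ K → ∀ τ ∈ badTerms mem jstar T K,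
      Fc K (HistorySocketTH.bstrOf sh mem K τ) * Rf K (HistorySocketTH.bstrOf sh mem K τ) ≤
        ∏ q ∈ mem K τ, pshapeTH sh O C 1 Λ' (R K) (g K) 0 (κ K q) q.2) :
    ∀ K t, |t| ≤ l₀ → K₀ ≤ K → ∀ τ ∈ badTerms mem jstar T K,
      Fc K (HistorySocketTH.bstrOf sh mem K τ) * Rf K (HistorySocketTH.bstrOf sh mem K τ) ≤
        ∏ q ∈ mem K τ, priceT sh C Λ' R g K q := by
  intro K t ht hK τ hτ
  have hx : Fc K (HistorySocketTH.bstrOf sh mem K τ) * Rf K (HistorySocketTH.bstrOf sh mem K τ) ≤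
      ∏ q ∈ mem K τ, 1 * pshapeTH sh O C 1 Λ' (R K) (g K) 0 (κ K q) q.2 := by
    simpa only [one_mul] using hP K t ht hK τ hτ
  have h := hD.le_prod_shapeTH sh zero_le_one hΛ (R K) (g K) K 0 (mem K τ) (fun q => q.2) (mult := fun _ => 1)
    (fun _ _ => zero_le_one) (fun q => κ K q) (hκ K hK τ hτ) hx
  simpa only [one_mul, priceT_eq_cshapeTH] using h

/-- **… WITH THE CLASS-LINEAR SLACK**: the printed factors may carry, per member, an extra `e^{θ·birthLinT sh q.2}`
(print's resummation of admissible sequences ∕ lattice-animal entropy, class-linear in the births), paid by the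
birth-credit slack `C.a + θ ≤ ½γ₀A₁²` given a profile floor `1 ≤ p₀(g_{K,s})` at the members' birth steps
(`le_prod_shapeTH_of_slack`). [folklore] -/
theorem hprice_of_printed_slack (sh : ε → PEv) {θ : ℝ} (hθ : 0 ≤ θ) (hslack : C.a + θ ≤ O.γ₀ * O.A₁ ^ 2 / 2)
    {Λ' : ℝ} (hΛ : 0 ≤ Λ') (R : ℕ → ℕ → ℕ) (g : ℕ → ℕ → ℝ) {l₀ : ℝ} {K₀ : ℕ} {T : ℕ → Finset ι}
    {mem : ℕ → ι → Finset (γ × Gen ε)} {jstar : ℕ → ℕ} {Fc Rf : ℕ → Finset (BSlot γ PEv) → ℝ}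
    (hP1 : ∀ K, K₀ ≤ K → ∀ τ ∈ badTerms mem jstar T K, ∀ q ∈ mem K τ,
      ∀ e ∈ q.2.events, (sh e).kind = 0 → 1 ≤ p0Profile C.A₀ C.p₀ (g K (sh e).step))
    (κ : ℕ → γ × Gen ε → Gen ε → ℕ → ℝ)
    (hκ : ∀ K, K₀ ≤ K → ∀ τ ∈ badTerms mem jstar T K, ∀ q ∈ mem K τ,
      ∀ n ∈ life (padW (dictWT sh (R K) C.n₁) 0) q.2, κ K q q.2 n ≤ costT sh C K (R K) q.2 n)
    (hP : ∀ K t, |t| ≤ l₀ → K₀ ≤ K → ∀ τ ∈ badTerms mem jstar T K,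
      Fc K (HistorySocketTH.bstrOf sh mem K τ) * Rf K (HistorySocketTH.bstrOf sh mem K τ) ≤
        ∏ q ∈ mem K τ, pshapeTH sh O C 1 Λ' (R K) (g K) 0 (κ K q) q.2 * Real.exp (θ * birthLinT sh q.2)) :
    ∀ K t, |t| ≤ l₀ → K₀ ≤ K → ∀ τ ∈ badTerms mem jstar T K,
      Fc K (HistorySocketTH.bstrOf sh mem K τ) * Rf K (HistorySocketTH.bstrOf sh mem K τ) ≤
        ∏ q ∈ mem K τ, priceT sh C Λ' R g K q := by
  intro K t ht hK τ hτ
  have hx : Fc K (HistorySocketTH.bstrOf sh mem K τ) * Rf K (HistorySocketTH.bstrOf sh mem K τ) ≤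
      ∏ q ∈ mem K τ, 1 * (pshapeTH sh O C 1 Λ' (R K) (g K) 0 (κ K q) q.2 * Real.exp (θ * birthLinT sh q.2)) := by
    simpa only [one_mul] using hP K t ht hK τ hτ
  have h := le_prod_shapeTH_of_slack sh hθ hslack zero_le_one hΛ (R K) (g K) K 0 (mem K τ) (fun q => q.2)
    (mult := fun _ => 1) (fun _ _ => zero_le_one) (fun q => κ K q) (hP1 K hK τ hτ) (hκ K hK τ hτ) hx
  simpa only [one_mul, priceT_eq_cshapeTH] using h

end Printed

/-! ## §2 The END with printed prices -/

section End

variable {F : T4Family} {G : Type*} [GaugeGroup G] [MeasurableSpace G] [HaarData G] [RegularGaugeGroup G]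
variable {α π : Type*} [DecidableEq α] [DecidableEq π]
variable {ι : Type*} [DecidableEq ι] {l₀ vol : ℝ} {K₀ : ℕ} {T : ℕ → Finset ι} {A A' shA shB : ℕ → ℝ → ι → ℝ}
  {dead dead' : ℕ → ℝ → ι → ℝ} {nup mup : ℕ → ℝ → ℝ} {Nup : ℝ}
  {Cc Rr CcRec RrRec : ℕ → ℝ → ι → ℝ} {ν u s₂ q₀ r s Wsh : ℕ → ℝ}

/-- **NE7b's COUNT EXIT WITH THE LIVE STRUCTURES READ AS PEDIGREES AND THE PRICES READ IN PRINT'S CURRENCY.**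
`HistoryAssemblyPedigree.hybridNE7_of_pedigreeReading_canon` with the model-currency price readings REPLACED by:
`Dominates C O` (row S9: print's displayed per-operation constants `O : PrintedO1s` dominated by the model tables at
`C`), a realised per-step cost `κ`∕`κ′` of every live member read below the model's `costT` on its life (reading
(ID-a)), and H3's per-term price sentence for both runs in PRINT's currency (`pshapeTH … O C 1 (L^d) …`).  Everything
else as there.
STATUS — SUPERSEDED, KEPT AS A RECORD (referee OI-2, `t4/formal/NE7b/REFEREE.md` passes 4–14): on the TH line by the
shape-free form `HistoryAssemblyShapeFreeEnd.hybridNE7_of_pedigreeReading_printedH` (`hir` over `irThresholdH`, DV-6);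
on the realised (LE) road by the END-OF-RECORD chain `HistoryAssemblyRealisePrice.hybridNE7_of_realisedReading_printed`
(END (i): constant profile) → `HistoryAssemblyRealiseRunEnd.hybridNE7_of_realisedRun_printed` (per-run profile, R7,
`hβ : β₀ ≤ ½`, DV-8) → `HistoryRealiseCellsRunEnd.hybridNE7_of_realisedDomainsRun_printed` (END OF RECORD v2,
R-OWNER-22-25) → `HistoryRealiseCellsRunMultEnd.hybridNE7_of_realisedDomainsRun_printedT3b` (END OF RECORD v3,
R-OWNER-23-9: the slot multiplicity counted in the kernel); this theorem's `PedigreeReading` display (`RenewAtReach` in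
`Timed`) is the pre-S1b form and is consumed by no END of record. [folklore] -/
theorem hybridNE7_of_pedigreeReading_printed (D : FiniteEpsData F G) {C : T4PrintedShapeBanking.Consts}
    {O : PrintedO1s} (hD : Dominates C O)
    {rr : ℕ} {β₀ : ℝ} (h : ThresholdOK C F.L rr β₀) (hμ : 0 < C.μ) (d n : ℕ)
    (hκ₁ : (d : ℝ) * Real.log F.L + 2 * Real.log 2 ≤ C.κ₁) (hE₀ : Real.log (2 + birthMass C) ≤ C.E₀)
    -- the flow side (⇐ BetaPertH, displayed) and tuning
    {γ₀ γb b β' : ℝ} {pe : ℕ} (hb : 0 ≤ b) (hlo : FlowStep.BetaLowerH b γ₀ D.βfun)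
    (hhi : FlowStep.BetaUpperH β' γ₀ D.βfun) (hγ : γb ≤ γ₀) (hγβ : γb ^ 2 * β' < 1)
    (S : B14FlowStep.SmallnessFor γb β' β₀ F.L pe) (hp₀ : C.p₀ ≤ pe) (hrr : rr ≤ pe)
    {g : ℝ} {g₀ : ℕ → ℝ} (ht : D.Tuned γb g g₀)
    (hir : irThresholdTH (Prod.fst : Lab α π → PEv) C F.L rr β₀ 0 ≤ Real.log (g ^ 2)⁻¹)
    -- the (B) side
    (hsign : B16.SignConventions D.C) {γB : ℝ} {em ep : ℝ → ℝ} (hcor : B16.Cor3With D.C γB em ep) (hγB : γb ≤ γB)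
    {obs : (K : ℕ) → GaugeField (F.P K) 0 G → ℝ} {B : ℝ}
    (hobs : ∀ K, Measurable (obs K)) (hbd : ∀ K U, |obs K U| ≤ B)
    (hα : ∀ K t, |t| ≤ l₀ → K₀ ≤ K →
      ∫ U, Real.exp (t * obs K U) * D.dens K (g₀ K) 0 U ∂fieldMeasure (F.P K) 0 G ≤ ∑ τ ∈ T K, A K t τ)
    (hα' : ∀ K t, |t| ≤ l₀ → K₀ ≤ K →
      ∫ U, Real.exp (t * obs (K + 1) U) * D.dens (K + 1) (g₀ (K + 1)) 0 U ∂fieldMeasure (F.P (K + 1)) 0 G ≤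
        ∑ τ ∈ T K, A' K t τ)
    {c₀ n₁ : ℝ} (hc₀ : 0 < c₀) (hfloor : ∀ K, K₀ ≤ K → c₀ ≤ smallFieldMass D K (g₀ K))
    (hfloor' : ∀ K, K₀ ≤ K → c₀ ≤ smallFieldMass D (K + 1) (g₀ (K + 1)))
    (hsites : ∀ K, K₀ ≤ K → ((D.C ⟨K, F.m, g₀ K⟩).numSites K : ℝ) ≤ n₁)
    (hsites' : ∀ K, K₀ ≤ K → ((D.C ⟨K + 1, F.m, g₀ (K + 1)⟩).numSites (K + 1) : ℝ) ≤ n₁)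
    (hNup : 0 ≤ Nup) (hnup : ∀ K t, |t| ≤ l₀ → K₀ ≤ K → 0 ≤ nup K t ∧ nup K t ≤ Nup)
    (hmup : ∀ K t, |t| ≤ l₀ → K₀ ≤ K → 0 ≤ mup K t ∧ mup K t ≤ Nup)
    -- the (2.5) side condition on the size function
    (R : ℕ → ℕ → ℕ) (hR : ∀ K s, s ≤ K → B14.IsRj F.L rr ((D.C ⟨K, F.m, g₀ K⟩).flow.g s) (R K s))
    -- H3: the terms read as PEDIGREES of live components with root cells, and their reading
    (ped : ℕ → ι → Pedigree α π) (liveC : ℕ → ι → Finset α) (cellOf : ℕ → ι → α → (Fin d → ℕ))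
    (H : PedigreeReading C (cellN d n F.L) K₀ R T ped liveC cellOf)
    -- H3: realised per-step costs of the live members, read below the model's booked cost (reading (ID-a))
    (κ κ' : ℕ → (Fin d → ℕ) × Gen (Lab α π) → Gen (Lab α π) → ℕ → ℝ)
    (hκ : ∀ K, K₀ ≤ K → ∀ τ ∈ badTerms (memOf ped liveC cellOf) jhalf T K, ∀ q ∈ memOf ped liveC cellOf K τ,
      ∀ m ∈ life (padW (dictWT Prod.fst (R K) C.n₁) 0) q.2,
        κ K q q.2 m ≤ costT Prod.fst C K (R K) q.2 m)
    (hκ' : ∀ K, K₀ ≤ K → ∀ τ ∈ badTerms (memOf ped liveC cellOf) jhalf T K, ∀ q ∈ memOf ped liveC cellOf K τ,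
      ∀ m ∈ life (padW (dictWT Prod.fst (R K) C.n₁) 0) q.2,
        κ' K q q.2 m ≤ costT Prod.fst C K (R K) q.2 m)
    -- H3: the per-term price sentence in PRINT's currency, both runs
    {Fc Rf Fc' Rf' : ℕ → Finset (BSlot (Fin d → ℕ) PEv) → ℝ}
    (hP : ∀ K t, |t| ≤ l₀ → K₀ ≤ K → ∀ τ ∈ badTerms (memOf ped liveC cellOf) jhalf T K,
      Fc K (HistorySocketTH.bstrOf Prod.fst (memOf ped liveC cellOf) K τ) *
          Rf K (HistorySocketTH.bstrOf Prod.fst (memOf ped liveC cellOf) K τ) ≤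
        ∏ q ∈ memOf ped liveC cellOf K τ,
          pshapeTH Prod.fst O C 1 ((F.L : ℝ) ^ d) (R K) (D.C ⟨K, F.m, g₀ K⟩).flow.g 0 (κ K q) q.2)
    (hP' : ∀ K t, |t| ≤ l₀ → K₀ ≤ K → ∀ τ ∈ badTerms (memOf ped liveC cellOf) jhalf T K,
      Fc' K (HistorySocketTH.bstrOf Prod.fst (memOf ped liveC cellOf) K τ) *
          Rf' K (HistorySocketTH.bstrOf Prod.fst (memOf ped liveC cellOf) K τ) ≤
        ∏ q ∈ memOf ped liveC cellOf K τ,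
          pshapeTH Prod.fst O C 1 ((F.L : ℝ) ^ d) (R K) (D.C ⟨K, F.m, g₀ K⟩).flow.g 0 (κ' K q) q.2)
    -- H3: the remaining `Regeneration` numerator readings, over the classes of the terms
    (up : ∀ K t, |t| ≤ l₀ → K₀ ≤ K → ∀ c ∈ badClasses Prod.fst (memOf ped liveC cellOf) jhalf T K,
      ∀ τ ∈ fibre (HistorySocketTH.bstrOf Prod.fst (memOf ped liveC cellOf)) T K c,
        A K t τ ≤ dead K t τ * Fc K c * nup K t)
    (dead_nonneg : ∀ K t, |t| ≤ l₀ → K₀ ≤ K → ∀ c ∈ badClasses Prod.fst (memOf ped liveC cellOf) jhalf T K,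
      ∀ τ ∈ fibre (HistorySocketTH.bstrOf Prod.fst (memOf ped liveC cellOf)) T K c, 0 ≤ dead K t τ)
    (resum : ∀ K t, |t| ≤ l₀ → K₀ ≤ K → ∀ c ∈ badClasses Prod.fst (memOf ped liveC cellOf) jhalf T K,
      ∑ τ ∈ fibre (HistorySocketTH.bstrOf Prod.fst (memOf ped liveC cellOf)) T K c, dead K t τ ≤ Rf K c)
    (F_nonneg : ∀ K t, |t| ≤ l₀ → K₀ ≤ K → ∀ c ∈ badClasses Prod.fst (memOf ped liveC cellOf) jhalf T K, 0 ≤ Fc K c)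
    (up' : ∀ K t, |t| ≤ l₀ → K₀ ≤ K → ∀ c ∈ badClasses Prod.fst (memOf ped liveC cellOf) jhalf T K,
      ∀ τ ∈ fibre (HistorySocketTH.bstrOf Prod.fst (memOf ped liveC cellOf)) T K c,
        A' K t τ ≤ dead' K t τ * Fc' K c * mup K t)
    (dead'_nonneg : ∀ K t, |t| ≤ l₀ → K₀ ≤ K → ∀ c ∈ badClasses Prod.fst (memOf ped liveC cellOf) jhalf T K,
      ∀ τ ∈ fibre (HistorySocketTH.bstrOf Prod.fst (memOf ped liveC cellOf)) T K c, 0 ≤ dead' K t τ)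
    (resum' : ∀ K t, |t| ≤ l₀ → K₀ ≤ K → ∀ c ∈ badClasses Prod.fst (memOf ped liveC cellOf) jhalf T K,
      ∑ τ ∈ fibre (HistorySocketTH.bstrOf Prod.fst (memOf ped liveC cellOf)) T K c, dead' K t τ ≤ Rf' K c)
    (F'_nonneg : ∀ K t, |t| ≤ l₀ → K₀ ≤ K → ∀ c ∈ badClasses Prod.fst (memOf ped liveC cellOf) jhalf T K,
      0 ≤ Fc' K c)
    -- the seam's other inputs
    (hSh : ShellWeightBound l₀ T A A' shA shB Wsh)
    (hTB : ReindexedBudget l₀ vol T (fun K t τ => A K t τ - shA K t τ) (fun K t τ => A' K t τ - shB K t τ)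
      (badOfClass (HistorySocketTH.bstrOf Prod.fst (memOf ped liveC cellOf)) T
        (fun K _ => badClasses Prod.fst (memOf ped liveC cellOf) jhalf T K)) Cc Rr CcRec RrRec ν u s₂ q₀ r s)
    (hr : Summable r) (hu : Summable u) (hs : Summable s) (hs₂ : Summable s₂) :
    ∃ K₁ K₂, K₀ ≤ K₁ ∧ HybridNE7 l₀ vol (fun K => T (K₁ + (K₂ + K))) (fun K => A (K₁ + (K₂ + K)))
      (fun K => A' (K₁ + (K₂ + K)))
      (fun K => badOfClass (HistorySocketTH.bstrOf Prod.fst (memOf ped liveC cellOf)) T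
        (fun K _ => badClasses Prod.fst (memOf ped liveC cellOf) jhalf T K) (K₁ + (K₂ + K)))
      (fun K => constOf l₀ B (max (em g) 0) n₁ c₀ Nup *
        recordsBudget (birthMass C) C.κ₁ ((n : ℝ) ^ d) ((F.L : ℝ) ^ d) (Real.log 2) jhalf (K₁ + (K₂ + K)))
      (fun K => shA (K₁ + (K₂ + K))) (fun K => shB (K₁ + (K₂ + K))) (fun K => Wsh (K₁ + (K₂ + K)))
      (fun K => (r (K₁ + (K₂ + K)) + u (K₁ + (K₂ + K))) + (s (K₁ + (K₂ + K)) + s₂ (K₁ + (K₂ + K)))) :=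
  have hLpos : (0 : ℝ) < F.L := by exact_mod_cast (lt_of_lt_of_le (by norm_num) (two_le_L F))
  have hΛ : (0 : ℝ) ≤ (F.L : ℝ) ^ d := pow_nonneg hLpos.le d
  hybridNE7_of_pedigreeReading_canon D h hμ d n hκ₁ hE₀ hb hlo hhi hγ hγβ S hp₀ hrr ht hir hsign hcor hγB hobs hbd hα
    hα' hc₀ hfloor hfloor' hsites hsites' hNup hnup hmup R hR ped liveC cellOf H
    (hprice_of_printed Prod.fst hD hΛ R (fun K => (D.C ⟨K, F.m, g₀ K⟩).flow.g) κ hκ hP)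
    (hprice_of_printed Prod.fst hD hΛ R (fun K => (D.C ⟨K, F.m, g₀ K⟩).flow.g) κ' hκ' hP')
    up dead_nonneg resum F_nonneg up' dead'_nonneg resum' F'_nonneg hSh hTB hr hu hs hs₂

end End

end

end Summit.QuantumFields.BalabanUV.T4Continuum.HistoryAssemblyPrice
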